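import Summits.KontsevichZagierPeriods.KontsevichZagierPeriods.Theorems.ValuedFieldSpecialisationClassLevelExpansionFibreDimOneToolkit
import Summits.KontsevichZagierPeriods.KontsevichZagierPeriods.Theorems.SymplecticScissorsRealOnePeriodRelationsStubPuiseuxGerm
import Literature.NumberTheory.Transcendental.SemialgebraicAlgebraicPoints
import Literature.NumberTheory.Transcendental.KZSemialgebraicComplex

/-!
# Route ValuedFieldSpecialisation — even Puiseux parametrisation of bounded coefficients

Helper for item stmt-KontsevichZagierPeriods-3503 (`ClassLevelExpansionFibreDimOne`). The base
data of a prepared band (`a`, `θ`, `bᵢ`, the band edges) are `ℚ`-semialgebraic functions of the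
one parameter `s ∈ (0, ε)`. By the real Puiseux theorem of the tree
(`RealOnePeriodRelations.PuiseuxGerm.puiseuxGerm`: `p(s^q) = s^m h(s)` near `0⁺`, `h` analytic at
`0`) a BOUNDED such `p` is `p(s) = P(s^{1/(2q)})` with `P(ς) = ς^{2m} h(ς²)` analytic on a
two-sided interval `(−δ, δ)` AND `ℚ`-semialgebraic there — the even reparametrisation
`P(ς) = p(ς^{2q})` (`ς ≠ 0`) makes both properties evident. This is the form in which the
coefficients enter the analytic functions `G(ς, x)` that are Taylor-expanded in `ς`
(`…DirTaylor`).

* `exists_evenPuiseux` — one function; * `exists_evenPuiseux_family` — finitely many functions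
  with a COMMON exponent `2Q`.

Sources: J. Bochnak, M. Coste, M.-F. Roy (1998), §8.1 (real Puiseux series). Deliberately NOT
here: anything about representations.
-/

noncomputable section

namespace Summit.KontsevichZagierPeriods.ValuedFieldSpecialisation

open Set Filter
open scoped Topology
open Literature.NumberTheory.Transcendental
open Literature.ModelTheory.ExponentialFields (IsSemialgebraic isSemialgebraic_setOf_eval_pos
  isSemialgebraic_setOf_eval_eq_zero isSemialgebraic_setOf_eval_lt)

/-- The two-sided interval `{z : ℝ¹ | −δ < z 0 < δ}` is `ℚ`-semialgebraic for rational `δ`.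
[folklore] -/
theorem isSemialgebraic_Ioo_neg (δ : ℚ) :
    IsSemialgebraic ℚ {z : Fin 1 → ℝ | z 0 ∈ Ioo (-(δ : ℝ)) δ} := by
  have h1 : IsSemialgebraic ℚ {z : Fin 1 → ℝ | -(δ : ℝ) < z 0} := by
    simpa using isSemialgebraic_setOf_eval_lt (k := ℚ) (R := ℝ)
      (MvPolynomial.C (-δ)) (MvPolynomial.X (0 : Fin 1))
  have h2 : IsSemialgebraic ℚ {z : Fin 1 → ℝ | z 0 < (δ : ℝ)} := by
    simpa using isSemialgebraic_setOf_eval_lt (k := ℚ) (R := ℝ)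
      (MvPolynomial.X (0 : Fin 1)) (MvPolynomial.C δ)
  convert h1.inter h2 using 1
  ext z
  simp [mem_Ioo]

/-- A bounded germ cannot have a negative Puiseux order: if `p (s ^ q) = s ^ m * h s` near `0⁺`
with `h` continuous at `0`, `h 0 ≠ 0`, and `p` is bounded near `0⁺`, then `0 ≤ m`. [folklore] -/
theorem puiseux_order_nonneg {p h : ℝ → ℝ} {q : ℕ} {m : ℤ} {ε₂ M : ℝ} (hε₂ : 0 < ε₂)
    (hgerm : ∀ s, 0 < s → s < ε₂ → p (s ^ q) = s ^ m * h s) (hh : ContinuousAt h 0) (hh0 : h 0 ≠ 0)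
    (hbdd : ∀ s, 0 < s → s < ε₂ → |p (s ^ q)| ≤ M) : 0 ≤ m := by
  by_contra hm
  push Not at hm
  -- `|h s| ≥ |h 0| / 2` near `0`
  have hpos : 0 < |h 0| / 2 := by positivity
  obtain ⟨η, hη, hηh⟩ : ∃ η > 0, ∀ s, |s| < η → |h 0| / 2 ≤ |h s| := by
    have := Metric.continuousAt_iff.mp hh (|h 0| / 2) hpos
    obtain ⟨η, hη, hηh⟩ := this
    refine ⟨η, hη, fun s hs => ?_⟩
    have hd : dist (h s) (h 0) < |h 0| / 2 := hηh (by simpa [Real.dist_eq] using hs)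
    rw [Real.dist_eq] at hd
    have := abs_sub_abs_le_abs_sub (h 0) (h s)
    rw [abs_sub_comm] at this
    linarith
  -- choose `s` small with `s ^ m` huge
  set L : ℝ := (|M| + 1) / (|h 0| / 2) with hL
  have hL0 : 0 < L := by positivity
  -- `s ^ m = (s⁻¹) ^ (-m)` with `-m ≥ 1`
  obtain ⟨s, hs0, hsε, hsη, hsL⟩ : ∃ s : ℝ, 0 < s ∧ s < ε₂ ∧ s < η ∧ L < s ^ m := by
    set s : ℝ := min (min (ε₂ / 2) (η / 2)) (1 / (L + 1)) with hs
    have hs0 : 0 < s := by positivity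
    have hs1 : s ≤ 1 / (L + 1) := min_le_right _ _
    refine ⟨s, hs0, ?_, ?_, ?_⟩
    · exact (min_le_left _ _).trans_lt ((min_le_left _ _).trans_lt (by linarith))
    · exact (min_le_left _ _).trans_lt ((min_le_right _ _).trans_lt (by linarith))
    · have hsinv : L + 1 ≤ s⁻¹ := by
        rw [le_inv_comm₀ (by positivity) hs0]; simpa [one_div] using hs1
      have h1 : (1 : ℤ) ≤ -m := by omega
      have hs1' : 1 ≤ s⁻¹ := (by linarith : (1 : ℝ) ≤ L + 1).trans hsinv
      calc L < L + 1 := by linarith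
        _ ≤ s⁻¹ := hsinv
        _ = s⁻¹ ^ (1 : ℤ) := by simp
        _ ≤ s⁻¹ ^ (-m) := zpow_le_zpow_right₀ hs1' h1
        _ = s ^ m := by rw [inv_zpow', neg_neg]
  have h1 := hbdd s hs0 hsε
  rw [hgerm s hs0 hsε, abs_mul] at h1
  have h2 : |h 0| / 2 ≤ |h s| := hηh s (by rwa [abs_of_pos hs0])
  have h3 : L * (|h 0| / 2) ≤ |s ^ m| * |h s| := by
    refine mul_le_mul ?_ h2 hpos.le (abs_nonneg _)
    exact hsL.le.trans (le_abs_self _)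
  have h4 : L * (|h 0| / 2) = |M| + 1 := by rw [hL]; field_simp
  linarith [le_abs_self M]

/-- **Even Puiseux parametrisation of a bounded `ℚ`-semialgebraic coefficient.** If `p` is
`ℚ`-semialgebraic and bounded on `(0, ε)` then there are `q > 0`, `δ ∈ (0, 1]` (rational) and
`P : ℝ → ℝ`, analytic on `(−δ, δ)` and `ℚ`-semialgebraic there, with `P ς = p (ς ^ (2q))` for
`0 < |ς| < δ`; `P 0` is algebraic and is the limit of `p` at `0⁺`.
[Bochnak–Coste–Roy 1998, §8.1] [folklore] -/
theorem exists_evenPuiseux {p : ℝ → ℝ} {ε : ℝ} (hε : 0 < ε)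
    (hsa : IsSemialgebraicFunOn ℚ {z : Fin 1 → ℝ | z 0 ∈ Ioo (0 : ℝ) (0 + ε)} (fun z => p (z 0)))
    (hbdd : ∃ M, ∀ s, 0 < s → s < ε → |p s| ≤ M) :
    ∃ (q : ℕ) (P : ℝ → ℝ) (δ : ℚ), 0 < q ∧ 0 < δ ∧ δ ≤ 1 ∧
      AnalyticOnNhd ℝ P (Ioo (-(δ : ℝ)) δ) ∧
      IsSemialgebraicFunOn ℚ {z : Fin 1 → ℝ | z 0 ∈ Ioo (-(δ : ℝ)) δ} (fun z => P (z 0)) ∧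
      (∀ ς : ℝ, ς ∈ Ioo (-(δ : ℝ)) δ → ς ≠ 0 → P ς = p (ς ^ (2 * q))) ∧
      IsAlgebraic ℚ (P 0) ∧ Tendsto p (𝓝[>] 0) (𝓝 (P 0)) := by
  classical
  obtain ⟨M, hM⟩ := hbdd
  obtain ⟨q, m, h, hq, han, halg, hh0, hgerm⟩ :=
    Summit.KontsevichZagierPeriods.SymplecticScissors.RealOnePeriodRelations.PuiseuxGerm.puiseuxGerm
      p 0 ε isAlgebraic_zero hε hsa
  -- radius of analyticity of `h` and range of validity of the germ identity
  obtain ⟨r, hr, hball⟩ : ∃ r > 0, ∀ y : ℝ, |y| < r → AnalyticAt ℝ h y := by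
    obtain ⟨r, hr, h'⟩ := Metric.eventually_nhds_iff.mp han.eventually_analyticAt
    exact ⟨r, hr, fun y hy => h' (by simpa [Real.dist_eq] using hy)⟩
  obtain ⟨ε₂, hε₂0, hε₂⟩ : ∃ ε₂ > (0 : ℝ), ∀ s : ℝ, 0 < s → s < ε₂ → p (s ^ q) = s ^ m * h s := by
    rw [Filter.Eventually, mem_nhdsWithin] at hgerm
    obtain ⟨U, hUo, h0U, hU⟩ := hgerm
    obtain ⟨r, hr, hrU⟩ := Metric.isOpen_iff.mp hUo 0 h0U
    refine ⟨r, hr, fun s hs hsr => ?_⟩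
    have := hU ⟨hrU (by simpa [Real.dist_eq, abs_of_pos hs] using hsr), hs⟩
    simpa using this
  -- a rational `δ ≤ min (1, r, ε₂, ε)`
  obtain ⟨δ, hδ0, hδ1, hδr, hδε₂, hδε⟩ : ∃ δ : ℚ, 0 < δ ∧ δ ≤ 1 ∧ (δ : ℝ) ≤ r ∧ (δ : ℝ) ≤ ε₂ ∧
      (δ : ℝ) ≤ ε := by
    obtain ⟨δ, hδ0, hδ⟩ := exists_rat_btwn (show (0 : ℝ) < min (min 1 r) (min ε₂ ε) by positivity)
    refine ⟨δ, by exact_mod_cast hδ0, ?_, ?_, ?_, ?_⟩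
    · have : (δ : ℝ) ≤ 1 := hδ.le.trans ((min_le_left _ _).trans (min_le_left _ _))
      exact_mod_cast this
    · exact hδ.le.trans ((min_le_left _ _).trans (min_le_right _ _))
    · exact hδ.le.trans ((min_le_right _ _).trans (min_le_left _ _))
    · exact hδ.le.trans ((min_le_right _ _).trans (min_le_right _ _))
  have hδ0r : (0 : ℝ) < δ := by exact_mod_cast hδ0
  have hδ1r : (δ : ℝ) ≤ 1 := by exact_mod_cast hδ1
  -- squares of points of `(−δ, δ)`
  have hsq : ∀ ς : ℝ, ς ∈ Ioo (-(δ : ℝ)) δ → ς ^ 2 < δ := by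
    intro ς hς
    have habs : |ς| < δ := abs_lt.mpr hς
    calc ς ^ 2 = |ς| * |ς| := by rw [← sq_abs]; ring
      _ ≤ |ς| * 1 := by gcongr; exact habs.le.trans hδ1r
      _ < δ := by simpa using habs
  have hsq0 : ∀ ς : ℝ, ς ≠ 0 → 0 < ς ^ 2 := fun ς hς => by positivity
  have hIoo_sa := isSemialgebraic_Ioo_neg δ
  -- the two cases `h ≡ 0` / `h 0 ≠ 0`
  rcases hh0 with hh0 | hzero
  swap
  · -- `p = 0` near `0⁺`: take `P = 0`
    refine ⟨q, fun _ => 0, δ, hq, hδ0, hδ1, fun _ _ => analyticAt_const, ?_, fun ς hς hς0 => ?_,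
      isAlgebraic_zero, ?_⟩
    · simpa using isSemialgebraicFunOn_ratCast hIoo_sa 0
    · rw [pow_mul, hε₂ _ (hsq0 ς hς0) ((hsq ς hς).trans_le hδε₂), hzero, mul_zero]
    · refine tendsto_const_nhds.congr' ?_
      filter_upwards [Ioo_mem_nhdsGT (show (0 : ℝ) < (δ : ℝ) ^ q from pow_pos hδ0r q)] with s hs
      have hroot : (s ^ ((q : ℝ)⁻¹)) ^ q = s := Real.rpow_inv_natCast_pow hs.1.le hq.ne'
      have hlt : s ^ ((q : ℝ)⁻¹) < δ := by
        calc s ^ ((q : ℝ)⁻¹) < ((δ : ℝ) ^ q) ^ ((q : ℝ)⁻¹) :=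
              Real.rpow_lt_rpow hs.1.le hs.2 (by positivity)
          _ = δ := by rw [← Real.rpow_natCast, ← Real.rpow_mul hδ0r.le]; field_simp; simp
      have := hε₂ _ (Real.rpow_pos_of_pos hs.1 _) (hlt.trans_le hδε₂)
      rw [hroot, hzero, mul_zero] at this
      exact this.symm
  -- main case: `0 ≤ m`
  have hm : 0 ≤ m := by
    refine puiseux_order_nonneg (M := M) hδ0r (fun s hs hsδ => hε₂ s hs (hsδ.trans_le hδε₂))
      han.continuousAt hh0 fun s hs hsδ => hM _ (by positivity) ?_
    calc s ^ q ≤ s := pow_le_of_le_one hs.le (hsδ.le.trans hδ1r) hq.ne'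
      _ < ε := hsδ.trans_le hδε
  lift m to ℕ using hm
  have hP0alg : IsAlgebraic ℚ (((0 : ℝ) ^ 2) ^ m * h ((0 : ℝ) ^ 2)) := by
    have h0 : IsAlgebraic ℚ (h 0) := by simpa using halg 0
    simpa using ((isAlgebraic_zero (R := ℚ) (A := ℝ)).pow m).mul h0
  have hident : ∀ ς : ℝ, ς ∈ Ioo (-(δ : ℝ)) δ → ς ≠ 0 →
      (ς ^ 2) ^ m * h (ς ^ 2) = p (ς ^ (2 * q)) := by
    intro ς hς hς0
    rw [pow_mul, hε₂ _ (hsq0 ς hς0) ((hsq ς hς).trans_le hδε₂), zpow_natCast]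
  refine ⟨q, fun ς => (ς ^ 2) ^ m * h (ς ^ 2), δ, hq, hδ0, hδ1, ?_, ?_, hident, hP0alg, ?_⟩
  · -- analytic on `(−δ, δ)`
    intro ς hς
    have h2 : AnalyticAt ℝ (fun ς : ℝ => ς ^ 2) ς := analyticAt_id.pow 2
    have hh : AnalyticAt ℝ h (ς ^ 2) :=
      hball _ (by rw [abs_of_nonneg (sq_nonneg _)]; exact (hsq ς hς).trans_le hδr)
    have hh2 : AnalyticAt ℝ (fun ς : ℝ => h (ς ^ 2)) ς := hh.comp_of_eq h2 rfl
    exact (h2.pow m).mul hh2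
  · -- `ℚ`-semialgebraic on `(−δ, δ)`: glue `{ς ≠ 0}` (composition with `ς ↦ ς^{2q}`) and `{ς = 0}`
    have hne : IsSemialgebraic ℚ {z : Fin 1 → ℝ | z 0 ≠ 0} := by
      have := (isSemialgebraic_setOf_eval_eq_zero (k := ℚ) (R := ℝ) (MvPolynomial.X (0 : Fin 1))).compl
      convert this using 1
      ext z; simp
    have hS1 : IsSemialgebraic ℚ {z : Fin 1 → ℝ | z 0 ∈ Ioo (-(δ : ℝ)) δ ∧ z 0 ≠ 0} := by
      simpa [setOf_and] using hIoo_sa.inter hne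
    have hS2 : IsSemialgebraic ℚ {z : Fin 1 → ℝ | z 0 = 0} := by
      simpa using isSemialgebraic_setOf_eval_eq_zero (k := ℚ) (R := ℝ) (MvPolynomial.X (0 : Fin 1))
    have hf1 : IsSemialgebraicFunOn ℚ {z : Fin 1 → ℝ | z 0 ∈ Ioo (-(δ : ℝ)) δ ∧ z 0 ≠ 0}
        (fun z => p ((z 0) ^ (2 * q))) := by
      refine IsSemialgebraicFunOn.comp_isSemialgebraicMapOn_holds
        (t := {z : Fin 1 → ℝ | z 0 ∈ Ioo (0 : ℝ) (0 + ε)}) hsa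
        (f := fun z : Fin 1 → ℝ => fun _ : Fin 1 => (z 0) ^ (2 * q)) ?_ ?_
      · refine IsSemialgebraicMapOn.of_forall hS1 fun j => ?_
        simpa using isSemialgebraicFunOn_aeval hS1 ((MvPolynomial.X (0 : Fin 1)) ^ (2 * q))
      · intro z hz
        simp only [mem_setOf_eq, zero_add, mem_Ioo]
        refine ⟨by rw [pow_mul]; exact pow_pos (hsq0 _ hz.2) q, ?_⟩
        calc (z 0) ^ (2 * q) = ((z 0) ^ 2) ^ q := pow_mul _ _ _
          _ ≤ (z 0) ^ 2 := pow_le_of_le_one (sq_nonneg _) ((hsq _ hz.1).le.trans hδ1r) hq.ne'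
          _ < δ := hsq _ hz.1
          _ ≤ ε := hδε
    have hf2 : IsSemialgebraicFunOn ℚ {z : Fin 1 → ℝ | z 0 = 0}
        (fun _ => ((0 : ℝ) ^ 2) ^ m * h ((0 : ℝ) ^ 2)) :=
      isSemialgebraicFunOn_const_of_isAlgebraic hS2 hP0alg
    refine (hf1.union hf2 (fun z hz => hident _ hz.1 hz.2) (fun z hz => ?_)).mono (fun z hz => ?_)
      hIoo_sa
    · simp only [mem_setOf_eq] at hz
      simp [hz]
    · by_cases h0 : z 0 = 0
      · exact Or.inr h0
      · exact Or.inl ⟨hz, h0⟩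
  · -- the limit at `0⁺`
    have hc : (0 : ℝ) < ((2 * q : ℕ) : ℝ)⁻¹ := by positivity
    have hcont : ContinuousAt (fun ς : ℝ => (ς ^ 2) ^ m * h (ς ^ 2)) 0 := by
      have h2 : ContinuousAt (fun ς : ℝ => ς ^ 2) 0 := (continuous_pow 2).continuousAt
      have hh : ContinuousAt h ((0 : ℝ) ^ 2) := by simpa using han.continuousAt
      have hh2 : ContinuousAt (fun ς : ℝ => h (ς ^ 2)) 0 := hh.comp_of_eq h2 rfl
      exact (h2.pow m).mul hh2
    have hroot : Tendsto (fun s : ℝ => s ^ (((2 * q : ℕ) : ℝ)⁻¹)) (𝓝[>] 0) (𝓝 0) := by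
      have := (Real.continuousAt_rpow_const 0 _ (Or.inr hc.le)).tendsto
      rw [Real.zero_rpow hc.ne'] at this
      exact tendsto_nhdsWithin_of_tendsto_nhds this
    have hlim := hcont.tendsto.comp hroot
    refine hlim.congr' ?_
    have hq2 : (2 * q : ℕ) ≠ 0 := by positivity
    filter_upwards [Ioo_mem_nhdsGT (show (0 : ℝ) < (δ : ℝ) ^ (2 * q) from pow_pos hδ0r _)]
      with s hs
    have hς0 : 0 < s ^ (((2 * q : ℕ) : ℝ)⁻¹) := Real.rpow_pos_of_pos hs.1 _
    have hςδ : s ^ (((2 * q : ℕ) : ℝ)⁻¹) < δ := by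
      calc s ^ (((2 * q : ℕ) : ℝ)⁻¹) < ((δ : ℝ) ^ (2 * q)) ^ (((2 * q : ℕ) : ℝ)⁻¹) :=
            Real.rpow_lt_rpow hs.1.le hs.2 hc
        _ = δ := Real.pow_rpow_inv_natCast hδ0r.le hq2
    have := hident _ ⟨by linarith, hςδ⟩ hς0.ne'
    simp only [Function.comp_apply]
    rw [this, Real.rpow_inv_natCast_pow hs.1.le hq2]

/-- Powers of points of `(−δ', δ')`, `δ' ≤ 1`, stay in `(−δ', δ')`. [folklore] -/
theorem pow_mem_Ioo_of_mem_Ioo {ς δ' : ℝ} (hδ'1 : δ' ≤ 1) (hς : ς ∈ Ioo (-δ') δ') {k : ℕ}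
    (hk : k ≠ 0) : ς ^ k ∈ Ioo (-δ') δ' := by
  have habs : |ς| < δ' := abs_lt.mpr hς
  have h1 : |ς| ≤ 1 := habs.le.trans hδ'1
  have : |ς ^ k| < δ' := by
    rw [abs_pow]
    exact (pow_le_of_le_one (abs_nonneg _) h1 hk).trans_lt habs
  exact abs_lt.mp this

/-- **Even Puiseux parametrisation of finitely many bounded coefficients with a common
exponent**: `p i s = P i (s ^ (1 / (2Q)))`, i.e. `P i ς = p i (ς ^ (2Q))` for `0 < |ς| < δ`, with
every `P i` analytic and `ℚ`-semialgebraic on `(−δ, δ)`, `P i 0` algebraic and the limit of `p i`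
at `0⁺`. [Bochnak–Coste–Roy 1998, §8.1] [folklore] -/
theorem exists_evenPuiseux_family {N : ℕ} {p : Fin N → ℝ → ℝ} {ε : ℝ} (hε : 0 < ε)
    (hsa : ∀ i, IsSemialgebraicFunOn ℚ {z : Fin 1 → ℝ | z 0 ∈ Ioo (0 : ℝ) (0 + ε)}
      (fun z => p i (z 0)))
    (hbdd : ∀ i, ∃ M, ∀ s, 0 < s → s < ε → |p i s| ≤ M) :
    ∃ (Q : ℕ) (P : Fin N → ℝ → ℝ) (δ : ℚ), 0 < Q ∧ 0 < δ ∧ δ ≤ 1 ∧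
      (∀ i, AnalyticOnNhd ℝ (P i) (Ioo (-(δ : ℝ)) δ)) ∧
      (∀ i, IsSemialgebraicFunOn ℚ {z : Fin 1 → ℝ | z 0 ∈ Ioo (-(δ : ℝ)) δ} (fun z => P i (z 0))) ∧
      (∀ i (ς : ℝ), ς ∈ Ioo (-(δ : ℝ)) δ → ς ≠ 0 → P i ς = p i (ς ^ (2 * Q))) ∧
      (∀ i, IsAlgebraic ℚ (P i 0)) ∧ (∀ i, Tendsto (p i) (𝓝[>] 0) (𝓝 (P i 0))) := by
  classical
  choose q P δ hq hδ0 hδ1 han hsa' hid halg hlim using fun i => exists_evenPuiseux hε (hsa i) (hbdd i)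
  -- common exponent `Q = ∏ qᵢ`, cofactors `kᵢ`
  set Q : ℕ := ∏ i, q i with hQ
  have hQ0 : 0 < Q := Finset.prod_pos fun i _ => hq i
  set k : Fin N → ℕ := fun i => ∏ j ∈ Finset.univ.erase i, q j with hk
  have hkQ : ∀ i, q i * k i = Q := fun i => Finset.mul_prod_erase _ _ (Finset.mem_univ i)
  have hk0 : ∀ i, k i ≠ 0 := fun i => (Finset.prod_pos fun j _ => hq j).ne'
  -- a common rational radius `δ' ≤ 1`
  obtain ⟨δ', hδ'0, hδ'1, hδ'le⟩ : ∃ δ' : ℚ, 0 < δ' ∧ δ' ≤ 1 ∧ ∀ i, δ' ≤ δ i := by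
    rcases isEmpty_or_nonempty (Fin N) with hN | hN
    · exact ⟨1, one_pos, le_rfl, fun i => (IsEmpty.false i).elim⟩
    · refine ⟨min 1 (Finset.univ.inf' Finset.univ_nonempty δ), lt_min one_pos ?_, min_le_left _ _,
        fun i => (min_le_right _ _).trans (Finset.inf'_le _ (Finset.mem_univ i))⟩
      exact (Finset.lt_inf'_iff _).mpr fun i _ => hδ0 i
  have hδ'1r : ((δ' : ℚ) : ℝ) ≤ 1 := by exact_mod_cast hδ'1
  have hmem : ∀ i (ς : ℝ), ς ∈ Ioo (-(δ' : ℝ)) δ' → ς ^ k i ∈ Ioo (-(δ i : ℝ)) (δ i) := by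
    intro i ς hς
    have h := pow_mem_Ioo_of_mem_Ioo hδ'1r hς (hk0 i)
    have hle : ((δ' : ℚ) : ℝ) ≤ δ i := by exact_mod_cast hδ'le i
    exact ⟨by linarith [h.1], h.2.trans_le hle⟩
  have hIoo_sa := isSemialgebraic_Ioo_neg δ'
  refine ⟨Q, fun i ς => P i (ς ^ k i), δ', hQ0, hδ'0, hδ'1, fun i ς hς => ?_, fun i => ?_,
    fun i ς hς hς0 => ?_, fun i => ?_, fun i => ?_⟩
  · exact (han i _ (hmem i ς hς)).comp_of_eq (analyticAt_id.pow (k i)) rfl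
  · refine IsSemialgebraicFunOn.comp_isSemialgebraicMapOn_holds
      (t := {z : Fin 1 → ℝ | z 0 ∈ Ioo (-(δ i : ℝ)) (δ i)}) (hsa' i)
      (f := fun z : Fin 1 → ℝ => fun _ : Fin 1 => (z 0) ^ k i) ?_ (fun z hz => hmem i _ hz)
    refine IsSemialgebraicMapOn.of_forall hIoo_sa fun j => ?_
    simpa using isSemialgebraicFunOn_aeval hIoo_sa ((MvPolynomial.X (0 : Fin 1)) ^ k i)
  · show P i (ς ^ k i) = p i (ς ^ (2 * Q))
    rw [hid i _ (hmem i ς hς) (pow_ne_zero _ hς0), ← pow_mul, ← hkQ i]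
    ring_nf
  · show IsAlgebraic ℚ (P i ((0 : ℝ) ^ k i))
    simpa [zero_pow (hk0 i)] using halg i
  · show Tendsto (p i) (𝓝[>] 0) (𝓝 (P i ((0 : ℝ) ^ k i)))
    simpa [zero_pow (hk0 i)] using hlim i

end Summit.KontsevichZagierPeriods.ValuedFieldSpecialisation
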